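import Summits.BirchSwinnertonDyer.BirchSwinnertonDyer.Theorems.SignedLowerHalvesKobayashiLowerHalfLargeImageKuriharaRigidityThreeEngine
import Summits.BirchSwinnertonDyer.Rank1Residual.Supersingular.KobayashiMainConjectureX7FouquetWan
import HarnessLib

/-!
# Line `kurihara_rigidity` of crux `KobayashiLowerHalfLargeImage` (route `SignedLowerHalves`, item
# stmt-BirchSwinnertonDyer-19001): the HARD stub at `p ≥ 5` — the `≤` half of Kim's Conjecture 1.10 on the
# large-image corner of X7 (= child C1 of the planner's split turnkey) — CUT by the Fouquet–Wan locus: on the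
# locus it FOLLOWS from the FW binder and the Castella–Sano converse binder; only its OFF-LOCUS part is open
# (cell `bsd-ssimc`, seat `bsd-line-slh-p1` lead gen 2, cycle 2; `--supports` 19001, helper; closes nothing)

HONEST FRAMING: compositions BY NAME; every open input displayed; nothing booked; BSD is not proved.

WHAT. The line's registered HARD stub `stub_kuriharaPartialInfty_le_tamagawa_X7` is EXACTLY crux-sized at
`p ≥ 5` (gen-1 equivalence p609449) and the planner promotes it (child C1 `KimTamagawaDefectLeLargeImage`). The
route's birth line cut the CRUX by the Fouquet–Wan locus «∃ ℓ ≠ p prime, multiplicative, non-split,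
`p ∤ ord_ℓ(Δ_min)`» (`kobayashiLowerHalfLargeImage_iff_offFwLocus_of_thm451_OPEN`, k3-c3 g3). This file
transports that cut to the HARD stub, so the C1 successor starts from the right statement: ON the locus, the FW
binder `FouquetWan2021_thm51_via_kobayashi74_OPEN` (FW Thm 5.1 ∘ Ko 7.4, PRE; w2's p613756 derives it from finer
inputs) gives `KobayashiMainConjecture W p ε`, and the lead's CONVERSE binder
`Kobayashi74_CastellaSano2026_kimTamagawaDefect_of_signedMC_OPEN` (Ko 7.4 ∘ CS Thm 1 (ii)⟹(i), PRE; p609053)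
turns a signed main conjecture into Kim's identity `∂^(∞)(δ̃) = ord_p ∏ c_ℓ`, whose `≤` half is the stub's
conclusion (`kimTamagawaDefectLe_X7_onFwLocus_of_fw51_of_converse_OPEN`). Hence
`le_half_X7_of_fw51_of_converse_OPEN_of_offLocus`: the registered HARD stub's statement ⟸ {hFW, hC, h5} + its
OFF-LOCUS restriction (`hLeOff`, the honest open content: X7 ∧ ¬CM ∧ Surj ∧ `p ≥ 5` pairs with NO non-split
multiplicative `ℓ` having `p ∤ ord_ℓ Δ_min` — the cell's census classes B ∪ C ∪ D ∪ E, 277 of the 1 281 surjective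
window pairs across all `p`); and the crux BY NAME from {all binders} + {`hLeOff`, Kurihara's conjecture at 3
on the good rows, the crux at X7@3 off the good rows and off the locus} (`kobayashiLowerHalfLargeImage_of_allBinders_of_offLocus_OPEN`).
Net: along this line every open statement at `p ≥ 5` now lives OFF the Fouquet–Wan locus. (On the locus the
`≤` half is thus PRE-closable per pair with NO Kurihara computation — a remark for the census.)

References: [FouquetWan2021] Thm 5.1 (PRE); [CastellaSano2026] Thm 1 (PRE); [Kobayashi2003] Thm 7.4, 4.1;
[Kim2022StructureSelmer] Conj 1.10, Thm 1.11; [KimKimSun2020] Thm 1.1; W-lev-9 audit.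
-/

set_option autoImplicit false

set_option linter.dupNamespace false

noncomputable section

open scoped Classical MatrixGroups ModularForm

open CongruenceSubgroup WeierstrassCurve Literature.NumberTheory.EllipticCurves
  Literature.NumberTheory.EllipticCurves.ModularForms
  Literature.NumberTheory.EllipticCurves.Rank1Residual
  Literature.NumberTheory.EllipticCurves.Rank1Residual.Typed
  Summit.BirchSwinnertonDyer.Rank1Residual.Supersingular
  Summit.BirchSwinnertonDyer.Rank1Residual.X4

namespace Summit.BirchSwinnertonDyer.BirchSwinnertonDyer.Theorems.KuriharaRigidity

section OnLocus

variable (W : WeierstrassCurve ℚ) [W.IsElliptic] [W.IsGloballyMinimal] (p : ℕ) [Fact p.Prime]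

/-- **ON the Fouquet–Wan locus the HARD stub's conclusion follows from two PREPRINT binders**: at an X7 pair
(`p ≥ 5`, non-CM, `a_p = 0`, `ρ̄` onto) with a non-split multiplicative prime `ℓ ≠ p`, `p ∤ ord_ℓ(Δ_min)`, GRANTED
`hFW` (FW Thm 5.1 ∘ Ko 7.4 ⟹ both signed main conjectures) and the converse binder `hC` (Ko 7.4 ∘ CS Thm 1
(ii)⟹(i): a signed main conjecture ⟹ Kim's identity) with the period fact `h5`: `X4.KimTamagawaDefectLeAt W p f`
for every newform `f` of `W`. Per pair; CONDITIONAL; closes nothing. [claim: FouquetWan2021, status: under-review]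
[claim: CastellaSano2026, status: under-review] [cite: Kobayashi2003, Thm. 7.4 (p. 13)] -/
theorem kimTamagawaDefectLe_X7_onFwLocus_of_fw51_of_converse_OPEN
    (hFW : FouquetWan2021_thm51_via_kobayashi74_OPEN)
    (hC : Kobayashi74_CastellaSano2026_kimTamagawaDefect_of_signedMC_OPEN)
    (h5 : realPeriodRat_eq_unit_mul_plusPeriod)
    (hp5 : 5 ≤ p) (hX : ClassX7 W p) (hcm : ¬ W.HasCM) (hap : W.frobeniusTrace p = 0) (hs : Surj W p)
    (hloc : ∃ (ℓ : ℕ) (_ : Fact ℓ.Prime), ℓ ≠ p ∧ W.HasMultiplicativeReductionAtPrime ℓ ∧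
        ¬ W.HasSplitMultiplicativeReductionAtPrime ℓ ∧ ¬ p ∣ padicValInt ℓ W.minimalDiscriminantInt)
    {N : ℕ} [NeZero N] (f : CuspForm (Gamma0 N) 2) (hf : IsNewformOf W f) : KimTamagawaDefectLeAt W p f := by
  have hp2 : p ≠ 2 := by omega
  have hMC : KobayashiMainConjecture W p 1 :=
    hFW W p hp2 hX.1.1 hap (ClassX7.irr W p hp2 hX) hloc 1
  exact ((kimTamagawaDefectAt_iff W p f).mp
    (KuriharaRigidity.kimTamagawaDefectAt_of_signedMC hC h5 W p hp5 hX.1.1 hap hcm hs hMC f hf)).1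

end OnLocus

/-- **The registered HARD stub `stub_kuriharaPartialInfty_le_tamagawa_X7` (its statement verbatim as the
conclusion) from the two PREPRINT binders and its OFF-LOCUS restriction**: GRANTED `hFW`, `hC`, `h5`, the `≤`
half of Kim's Conjecture 1.10 holds on the whole corner X7 ∧ ¬CM ∧ `a_p = 0` ∧ Surj ∧ `p ≥ 5` as soon as it holds
at the pairs with NO non-split multiplicative prime `ℓ ≠ p` having `p ∤ ord_ℓ(Δ_min)` (`hLeOff`, the open
content). Proof: excluded middle on the locus. CONDITIONAL; closes nothing. [claim: FouquetWan2021, status: under-review]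
[claim: CastellaSano2026, status: under-review] [cite: Kim2022StructureSelmer, Conj. 1.10] -/
theorem le_half_X7_of_fw51_of_converse_OPEN_of_offLocus
    (hFW : FouquetWan2021_thm51_via_kobayashi74_OPEN)
    (hC : Kobayashi74_CastellaSano2026_kimTamagawaDefect_of_signedMC_OPEN)
    (h5 : realPeriodRat_eq_unit_mul_plusPeriod)
    (hLeOff : ∀ (W : WeierstrassCurve ℚ) [W.IsElliptic] [W.IsGloballyMinimal] (p : ℕ) [Fact p.Prime],
      5 ≤ p → ClassX7 W p → ¬ W.HasCM → W.frobeniusTrace p = 0 → Surj W p →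
      ¬ (∃ (ℓ : ℕ) (_ : Fact ℓ.Prime), ℓ ≠ p ∧ W.HasMultiplicativeReductionAtPrime ℓ ∧
          ¬ W.HasSplitMultiplicativeReductionAtPrime ℓ ∧ ¬ p ∣ padicValInt ℓ W.minimalDiscriminantInt) →
      ∀ [NeZero (W.conductorNorm ℤ)] (f : CuspForm (Gamma0 (W.conductorNorm ℤ)) 2),
        IsNewformOf W f → KimTamagawaDefectLeAt W p f) :
    ∀ (W : WeierstrassCurve ℚ) [W.IsElliptic] [W.IsGloballyMinimal] (p : ℕ) [Fact p.Prime],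
      5 ≤ p → ClassX7 W p → ¬ W.HasCM → W.frobeniusTrace p = 0 → Surj W p →
      ∀ [NeZero (W.conductorNorm ℤ)] (f : CuspForm (Gamma0 (W.conductorNorm ℤ)) 2),
        IsNewformOf W f → kuriharaPartialInfty W p f ≤ (padicValNat p W.tamagawaProduct : ℕ∞) := by
  intro W _ _ p _ hp5 hX hcm hap hs _ f hf
  by_cases hloc : ∃ (ℓ : ℕ) (_ : Fact ℓ.Prime), ℓ ≠ p ∧ W.HasMultiplicativeReductionAtPrime ℓ ∧
      ¬ W.HasSplitMultiplicativeReductionAtPrime ℓ ∧ ¬ p ∣ padicValInt ℓ W.minimalDiscriminantInt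
  · exact kimTamagawaDefectLe_X7_onFwLocus_of_fw51_of_converse_OPEN W p hFW hC h5 hp5 hX hcm hap hs hloc f hf
  · exact hLeOff W p hp5 hX hcm hap hs hloc f hf

/-- **The crux BY NAME, every binder named, every open statement OFF the Fouquet–Wan locus or at `3`**: crux ⟸
binders {`hKK` Kim 1.11 ∘ Ko 7.4 (PUB), `hCS` CS Thm 1 ∘ Ko 7.4 (PRE), `hCSge` CS §2 `≥` reading (PRE), `hC` Ko 7.4 ∘ CS
(ii)⟹(i) (PRE), `h5` period `p ≥ 5` (PUB), `hKKS` KKS Thm 1.1 at 3 ∘ Ko 7.4 (flag `KKS20@3-MR-H4`), `h3` period at 3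
(PUB), `hFW` FW Thm 5.1 ∘ Ko 7.4 (PRE)} + OPEN {`hLeOff`: the `≤` half of Kim's Conj. 1.10 at the X7 ∧ ¬CM ∧ Surj ∧
`p ≥ 5` pairs OFF the FW locus; `hU`: Kurihara's conjecture at `3` on the good rows ((Tam)₁ ∧ `3 ∤ ∏ c_ℓ`);
`hR`: the crux at the X7@3 pairs off the good rows and off the locus}. CONDITIONAL; closes nothing; BSD is not
proved by this. [cite: Kim2022StructureSelmer, Thm. 1.11, Conj. 1.10] [claim: CastellaSano2026, status: under-review]
[claim: FouquetWan2021, status: under-review] [cite: KimKimSun2020, Thm. 1.1] [cite: Kobayashi2003, Thm. 7.4 (p. 13)] -/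
theorem kobayashiLowerHalfLargeImage_of_allBinders_of_offLocus_OPEN
    (hKK : Kim2026_thm111_via_kobayashi74) (hCS : CastellaSano2026_thm1_via_kobayashi74_OPEN)
    (hCSge : CastellaSano2026_sec2_tamagawaDefectGe_implicit_OPEN)
    (hC : Kobayashi74_CastellaSano2026_kimTamagawaDefect_of_signedMC_OPEN)
    (h5 : realPeriodRat_eq_unit_mul_plusPeriod)
    (hKKS : KimKimSun2020_thm11_via_kobayashi74_three) (h3 : realPeriodRat_eq_unit_mul_plusPeriod_three)
    (hFW : FouquetWan2021_thm51_via_kobayashi74_OPEN)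
    (hLeOff : ∀ (W : WeierstrassCurve ℚ) [W.IsElliptic] [W.IsGloballyMinimal] (p : ℕ) [Fact p.Prime],
      5 ≤ p → ClassX7 W p → ¬ W.HasCM → W.frobeniusTrace p = 0 → Surj W p →
      ¬ (∃ (ℓ : ℕ) (_ : Fact ℓ.Prime), ℓ ≠ p ∧ W.HasMultiplicativeReductionAtPrime ℓ ∧
          ¬ W.HasSplitMultiplicativeReductionAtPrime ℓ ∧ ¬ p ∣ padicValInt ℓ W.minimalDiscriminantInt) →
      ∀ [NeZero (W.conductorNorm ℤ)] (f : CuspForm (Gamma0 (W.conductorNorm ℤ)) 2),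
        IsNewformOf W f → KimTamagawaDefectLeAt W p f)
    (hU : ∀ (W : WeierstrassCurve ℚ) [W.IsElliptic] [W.IsGloballyMinimal] (p : ℕ) [Fact p.Prime],
      p = 3 → ClassX7 W p → ¬ W.HasCM → W.frobeniusTrace p = 0 → Surj W p → KimKimSun2020TamAt W p →
      ¬ p ∣ W.tamagawaProduct →
      ∀ [NeZero (W.conductorNorm ℤ)] (f : CuspForm (Gamma0 (W.conductorNorm ℤ)) 2),
        IsNewformOf W f → KuriharaUnitAt W p f)
    (hR : ∀ (W : WeierstrassCurve ℚ) [W.IsElliptic] [W.IsGloballyMinimal] (p : ℕ) [Fact p.Prime],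
      p = 3 → ClassX7 W p → ¬ W.HasCM → W.frobeniusTrace p = 0 → Surj W p →
      ¬ (KimKimSun2020TamAt W p ∧ ¬ p ∣ W.tamagawaProduct) →
      ¬ (∃ (ℓ : ℕ) (_ : Fact ℓ.Prime), ℓ ≠ p ∧ W.HasMultiplicativeReductionAtPrime ℓ ∧
          ¬ W.HasSplitMultiplicativeReductionAtPrime ℓ ∧ ¬ p ∣ padicValInt ℓ W.minimalDiscriminantInt) →
      ∃ ε : ℤˣ, KobayashiLowerDivisibility W p ε) :
    Summit.BirchSwinnertonDyer.BirchSwinnertonDyer.Theses.SignedLowerHalves.KobayashiLowerHalfLargeImage :=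
  kobayashiLowerHalfLargeImage_of_readings_of_kks_OPEN hKK hCS hCSge h5 hKKS h3
    (le_half_X7_of_fw51_of_converse_OPEN_of_offLocus hFW hC h5 hLeOff) hU
    (fun W _ _ p _ hp3 hX hcm hap hs hT => by
      by_cases hloc : ∃ (ℓ : ℕ) (_ : Fact ℓ.Prime), ℓ ≠ p ∧ W.HasMultiplicativeReductionAtPrime ℓ ∧
          ¬ W.HasSplitMultiplicativeReductionAtPrime ℓ ∧ ¬ p ∣ padicValInt ℓ W.minimalDiscriminantInt
      · exact X7.kobayashiLowerDivisibility_of_thm51_OPEN W p hFW (by omega) hX hap hloc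
      · exact hR W p hp3 hX hcm hap hs hT hloc)

end Summit.BirchSwinnertonDyer.BirchSwinnertonDyer.Theorems.KuriharaRigidity
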